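import Summits.AtomisticToContinuum.Crystallization.Theorems.FrustratedLawDichotomyBumpAutocorrelation
import Mathlib.MeasureTheory.Integral.IntervalIntegral.IntegrationByParts

/-!
# FrustratedLawDichotomy · the RADIAL CONVOLUTION FORMULA in `ℝ³` (bookkeeping beneath the Schur-floor domination certificate)

After `…BumpAutocorrelation` (profile identity `β⋆β = (512π/3465)·omega₂(‖·‖)`) and `…BumpSchurFloor` (`SF₅` / `SF₄₅` / `SF₄` from a
dominator `K : ℝ³ → ℝ` ALONE), the one remaining input of lens-5 g34's Schur floors is the domination
`−(V·w)(‖z‖) ≤ ∫ K(u)·(β_a⋆β_a)(z − u) du` for all `z` — a THREE-dimensional convolution inequality as typed.  Lens-5's certificate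
(NODE-g34.md §3, census TAG 181-S(i)) is ONE-dimensional: for RADIAL `K(u) = κ(‖u‖)` the convolution of two radial functions is radial with
profile `(2π/r) ∫₀^∞ s κ(s) ∫_{|r−s|}^{r+s} τ k̃(τ) dτ ds`.  THIS FILE PROVES that formula (DEF-FREE, Mathlib + the slab map of
`…BumpAutocorrelation`):

  `radial_convolution : z ≠ 0 → ∫ u, κ ‖u‖ * f ‖u − z‖ = 2π/‖z‖ · ∫ s in Ioi 0, s·κ s · ∫ τ in |‖z‖−s|..(‖z‖+s), τ·f τ`

for continuous `κ`, `f` with `f` vanishing on `[T, ∞)` (`T ≥ 0`; here `f = omega₂(·/a)`, `T = 2a`).  Route — no Jacobians, only two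
one-variable substitutions and one Fubini swap: §1 `∫_{ℝ²} Φ(‖y‖²) dy = π∫_{σ>0} Φ` (general form of `radial2`); §2 slab reduction
`∫ κ(‖u‖) f(‖u − r e₀‖) du = ∫_t π ∫_{σ>0} κ(√(t²+σ)) f(√((t−r)²+σ)) dσ dt`; §3 `σ = s² − t²` on the half line (`integral_comp_mul_deriv_Ioi`);
§4 `τ² = s² + r² − 2rt` on `[−s, s]` (affine map + `integral_comp_mul_deriv`): `∫_{−s}^{s} f(√(s²+r²−2rt)) dt = r⁻¹∫_{|r−s|}^{r+s} τ f(τ) dτ`;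
§5 the swap over the cone `{|t| < s}` (`integral_integral_swap`; the integrand is bounded with bounded support); §6 assembly on the axis and
the general centre by the reflection `Submodule.reflection_sub`.

[folklore]; 0 sorry.  Prover hand 1, gen 13 (decomp-a2c), `--supports stmt-AtomisticToContinuum-27623`.
-/

noncomputable section

namespace Summit.AtomisticToContinuum.Crystallization.Theorems.FrustratedLawDichotomyBumpAutocorrelation

open MeasureTheory Set Real Filter
open scoped BigOperators Topology

/-! ## §1. The planar radial integral, general form -/

/-- `∫_{ℝ²} Φ(‖y‖²) dy = π ∫_{σ>0} Φ(σ) dσ` (an identity of Bochner integrals, no integrability hypothesis). [folklore] -/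
theorem integral_plane_radial (Φ : ℝ → ℝ) : ∫ y : EuclideanSpace ℝ (Fin 2), Φ (‖y‖ ^ 2) = π * ∫ σ in Ioi 0, Φ σ := by
  have h := MeasureTheory.integral_fun_norm_addHaar (volume : Measure (EuclideanSpace ℝ (Fin 2))) (fun ρ => Φ (ρ ^ 2))
  rw [h]
  have hdim : Module.finrank ℝ (EuclideanSpace ℝ (Fin 2)) = 2 := by simp
  rw [hdim]
  have hball : (volume : Measure (EuclideanSpace ℝ (Fin 2))).real (Metric.ball (0:EuclideanSpace ℝ (Fin 2)) 1) = π := by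
    rw [measureReal_def, EuclideanSpace.volume_ball_fin_two]
    simp [ENNReal.toReal_ofReal Real.pi_pos.le]
  rw [hball]
  have hsub := integral_comp_rpow_Ioi_of_pos (g := Φ) (p := 2) two_pos
  have e : ∫ x in Ioi (0:ℝ), ((2:ℝ) * x ^ ((2:ℝ) - 1)) • Φ (x ^ (2:ℝ)) = 2 * ∫ y in Ioi (0:ℝ), y ^ (2 - 1) • Φ (y ^ 2) := by
    rw [← integral_const_mul]
    refine setIntegral_congr_fun measurableSet_Ioi fun x (hx : 0 < x) => ?_
    simp only [smul_eq_mul]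
    rw [show (2:ℝ) - 1 = 1 by norm_num, Real.rpow_one, Real.rpow_two]
    ring
  rw [e] at hsub
  simp only [nsmul_eq_mul, smul_eq_mul, Nat.cast_ofNat] at hsub ⊢
  linear_combination π * hsub

/-! ## §2. Slab reduction of a radial-pair integral -/

/-- `‖slab⁻¹(t,y) − s e₀‖ = √((t − s)² + ‖y‖²)`. [folklore] -/
theorem norm_slab_symm_sub (t s : ℝ) (y : EuclideanSpace ℝ (Fin 2)) :
    ‖slab.symm (t, y) - s • e0‖ = √((t - s) ^ 2 + ‖y‖ ^ 2) := by
  rw [← norm_sq_slab_symm_sub, Real.sqrt_sq (norm_nonneg _)]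

/-- `‖slab⁻¹(t,y)‖ = √(t² + ‖y‖²)`. [folklore] -/
theorem norm_slab_symm (t : ℝ) (y : EuclideanSpace ℝ (Fin 2)) : ‖slab.symm (t, y)‖ = √(t ^ 2 + ‖y‖ ^ 2) := by
  rw [← norm_sq_slab_symm, Real.sqrt_sq (norm_nonneg _)]

/-- **Slab reduction**: for an integrable radial pair, `∫ κ(‖u‖) f(‖u − r e₀‖) du = ∫_ℝ π ∫_{σ>0} κ(√(t²+σ)) f(√((t−r)²+σ)) dσ dt`. [folklore] -/
theorem integral_radialPair_slab (κ f : ℝ → ℝ) (r : ℝ)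
    (hint : Integrable (fun u : EuclideanSpace ℝ (Fin 3) => κ ‖u‖ * f ‖u - r • e0‖)) :
    ∫ u : EuclideanSpace ℝ (Fin 3), κ ‖u‖ * f ‖u - r • e0‖ =
      ∫ t, π * ∫ σ in Ioi 0, κ (√(t ^ 2 + σ)) * f (√((t - r) ^ 2 + σ)) := by
  set G : EuclideanSpace ℝ (Fin 3) → ℝ := fun u => κ ‖u‖ * f ‖u - r • e0‖ with hG
  have h1 : ∫ u, G u = ∫ p, G (slab.symm p) := ((measurePreserving_slab.symm slab).integral_comp' G).symm
  have hint' : Integrable (fun p : ℝ × EuclideanSpace ℝ (Fin 2) => G (slab.symm p)) :=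
    ((measurePreserving_slab.symm slab).integrable_comp_emb slab.symm.measurableEmbedding).mpr hint
  rw [h1, MeasureTheory.Measure.volume_eq_prod, integral_prod _ ((MeasureTheory.Measure.volume_eq_prod ℝ (EuclideanSpace ℝ (Fin 2))) ▸ hint')]
  refine integral_congr_ae (Filter.Eventually.of_forall fun t => ?_)
  show ∫ y : EuclideanSpace ℝ (Fin 2), G (slab.symm (t, y)) = π * ∫ σ in Ioi 0, κ (√(t ^ 2 + σ)) * f (√((t - r) ^ 2 + σ))
  simp only [hG, norm_slab_symm, norm_slab_symm_sub]
  exact integral_plane_radial (fun σ => κ (√(t ^ 2 + σ)) * f (√((t - r) ^ 2 + σ)))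

/-! ## §3. One-variable bookkeeping: integrability of continuous functions vanishing at infinity -/

/-- A continuous function vanishing on `[b, ∞)` is integrable on `[a, ∞)`. [folklore] -/
theorem integrableOn_Ici_of_eq_zero {h : ℝ → ℝ} (hc : Continuous h) {a b : ℝ} (hz : ∀ x, b ≤ x → h x = 0) :
    IntegrableOn h (Ici a) := by
  have h1 : IntegrableOn h (Icc a b) := hc.integrableOn_Icc
  have h2 : IntegrableOn h (Ici b) :=
    (integrableOn_congr_fun (fun x hx => (hz x hx).symm) measurableSet_Ici).mp integrableOn_zero
  exact (h1.union h2).mono_set fun x hx => by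
    rcases le_or_gt b x with hb | hb
    · exact Or.inr hb
    · exact Or.inl ⟨hx, hb.le⟩

/-- **The substitution `σ = s² − t²`** on the half line: for continuous `κ`, `f` with `f` vanishing on `[T, ∞)`,
`∫_{σ>0} κ(√(t²+σ)) f(√((t−r)²+σ)) dσ = ∫_{s>|t|} 2s·κ(s)·f(√(s² + r² − 2rt)) ds`. [folklore] -/
theorem inner_subst (κ f : ℝ → ℝ) (hκ : Continuous κ) (hf : Continuous f) {T : ℝ} (hT : ∀ x, T ≤ x → f x = 0) (t r : ℝ) :
    ∫ σ in Ioi 0, κ (√(t ^ 2 + σ)) * f (√((t - r) ^ 2 + σ)) =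
      ∫ s in Ioi |t|, 2 * s * (κ s * f (√(s ^ 2 + r ^ 2 - 2 * r * t))) := by
  set g : ℝ → ℝ := fun σ => κ (√(t ^ 2 + σ)) * f (√((t - r) ^ 2 + σ)) with hg
  have hgc : Continuous g := by
    rw [hg]
    exact (hκ.comp (by fun_prop)).mul (hf.comp (by fun_prop))
  set φ : ℝ → ℝ := fun s => s ^ 2 - t ^ 2 with hφ
  have hφa : φ |t| = 0 := by simp [hφ, sq_abs]
  -- g vanishes beyond T² (f factor)
  have hgz : ∀ σ, T ^ 2 ≤ σ → g σ = 0 := fun σ hσ => by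
    have : T ≤ √((t - r) ^ 2 + σ) := by
      rcases le_or_gt 0 T with hT0 | hT0
      · rw [← Real.sqrt_sq hT0]; exact Real.sqrt_le_sqrt (by nlinarith)
      · exact hT0.le.trans (Real.sqrt_nonneg _)
    simp [hg, hT _ this]
  have hmain := integral_comp_mul_deriv_Ioi (f := φ) (f' := fun s => 2 * s) (g := g) (a := |t|)
    (by fun_prop) ?tend (fun s _ => by
      have : HasDerivAt φ (2 * s) s := by
        have h := (hasDerivAt_pow 2 s).sub_const (t ^ 2)
        simpa [hφ] using h
      exact this.hasDerivWithinAt)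
    hgc.continuousOn ?int1 ?int2
  case tend =>
    refine tendsto_atTop_add_const_right _ _ ?_
    exact tendsto_pow_atTop two_ne_zero
  case int1 =>
    refine (integrableOn_Ici_of_eq_zero hgc (a := 0) hgz).mono_set ?_
    rintro _ ⟨s, hs, rfl⟩
    have hs' : |t| ≤ s := hs
    show 0 ≤ s ^ 2 - t ^ 2
    nlinarith [abs_nonneg t, sq_abs t, hs']
  case int2 =>
    have hc2 : Continuous fun s => (g ∘ φ) s * (2 * s) := (hgc.comp (by fun_prop)).mul (by fun_prop)
    refine integrableOn_Ici_of_eq_zero hc2 (b := √(t ^ 2 + T ^ 2)) fun s hs => ?_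
    have hs0 : 0 ≤ s := (Real.sqrt_nonneg _).trans hs
    have : T ^ 2 ≤ φ s := by
      have h2 : t ^ 2 + T ^ 2 ≤ s ^ 2 := by
        calc t ^ 2 + T ^ 2 = √(t ^ 2 + T ^ 2) ^ 2 := (Real.sq_sqrt (by positivity)).symm
          _ ≤ s ^ 2 := pow_le_pow_left₀ (Real.sqrt_nonneg _) hs 2
      show T ^ 2 ≤ s ^ 2 - t ^ 2
      linarith
    simp [Function.comp, hgz _ this]
  rw [hφa] at hmain
  rw [← hmain]
  refine setIntegral_congr_fun measurableSet_Ioi fun s (hs : |t| < s) => ?_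
  have hs0 : 0 ≤ s := (abs_nonneg t).trans hs.le
  simp only [Function.comp, hg, hφ]
  rw [show t ^ 2 + (s ^ 2 - t ^ 2) = s ^ 2 by ring, Real.sqrt_sq hs0,
    show (t - r) ^ 2 + (s ^ 2 - t ^ 2) = s ^ 2 + r ^ 2 - 2 * r * t by ring]
  ring

/-! ## §4. The inner `t`-integral: the substitution `τ² = s² + r² − 2rt` -/

/-- **The `τ`-substitution**: for continuous `f`, `r > 0`, `s ≥ 0`,
`∫_{−s}^{s} f(√(s² + r² − 2rt)) dt = r⁻¹ ∫_{|r−s|}^{r+s} τ f(τ) dτ`. [folklore] -/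
theorem inner_tau (f : ℝ → ℝ) (hf : Continuous f) {r s : ℝ} (hr : 0 < r) (hs : 0 ≤ s) :
    ∫ t in (-s)..s, f (√(s ^ 2 + r ^ 2 - 2 * r * t)) = r⁻¹ * ∫ τ in |r - s|..(r + s), τ * f τ := by
  -- step (i): the affine substitution
  have h1 : ∫ t in (-s)..s, f (√(s ^ 2 + r ^ 2 - 2 * r * t)) = ∫ t in (-s)..s, (fun σ => f (√σ)) ((-2 * r) * t + (s ^ 2 + r ^ 2)) := by
    refine intervalIntegral.integral_congr fun t _ => ?_
    simp only
    congr 2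
    ring
  rw [h1, intervalIntegral.integral_comp_mul_add (fun σ => f (√σ)) (by linarith : (-2 * r) ≠ 0)]
  rw [show (-2 * r) * (-s) + (s ^ 2 + r ^ 2) = (r + s) ^ 2 by ring, show (-2 * r) * s + (s ^ 2 + r ^ 2) = |r - s| ^ 2 by
    rw [sq_abs]; ring]
  -- step (ii): σ = τ²
  have habs : |r - s| ≤ r + s := by
    rw [abs_le]; constructor <;> linarith
  have h2 := intervalIntegral.integral_comp_mul_deriv (a := |r - s|) (b := r + s) (f := fun τ => τ ^ 2) (f' := fun τ => 2 * τ)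
    (g := fun σ => f (√σ)) (fun τ _ => by simpa using hasDerivAt_pow 2 τ) (by fun_prop) (hf.comp Real.continuous_sqrt)
  -- h2 : ∫ τ in |r-s|..(r+s), ((fun σ => f √σ) ∘ (fun τ => τ^2)) τ * (2τ) = ∫ σ in |r-s|^2..(r+s)^2, f √σ
  rw [intervalIntegral.integral_symm (|r - s| ^ 2) ((r + s) ^ 2), ← h2]
  have h3 : ∫ τ in |r - s|..(r + s), ((fun σ => f (√σ)) ∘ fun τ => τ ^ 2) τ * (2 * τ) = 2 * ∫ τ in |r - s|..(r + s), τ * f τ := by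
    rw [← intervalIntegral.integral_const_mul]
    refine intervalIntegral.integral_congr fun τ hτ => ?_
    rw [uIcc_of_le habs] at hτ
    have hτ0 : 0 ≤ τ := (abs_nonneg _).trans hτ.1
    simp only [Function.comp, Real.sqrt_sq hτ0]
    ring
  rw [h3, smul_eq_mul]
  field_simp

/-! ## §5. Swapping the `t`- and `s`-integrals over the cone `|t| < s` -/

/-- Over the cone `{|t| < s}` the order of integration may be swapped for an integrand `2s·κ(s)·f(√(s²+r²−2rt))` with `κ`, `f` continuous,
`f` vanishing on `[T, ∞)` (`T ≥ 0`, `r ≥ 0`): `∫_t ∫_{s>|t|} = ∫_{s>0} ∫_{t∈(−s,s)}`. [folklore] -/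
theorem swap_cone (κ f : ℝ → ℝ) (hκ : Continuous κ) (hf : Continuous f) {T : ℝ} (hT0 : 0 ≤ T) (hT : ∀ x, T ≤ x → f x = 0)
    {r : ℝ} (hr : 0 ≤ r) :
    ∫ t, ∫ s in Ioi |t|, 2 * s * (κ s * f (√(s ^ 2 + r ^ 2 - 2 * r * t))) =
      ∫ s in Ioi 0, ∫ t in (-s)..s, 2 * s * (κ s * f (√(s ^ 2 + r ^ 2 - 2 * r * t))) := by
  set H : ℝ → ℝ → ℝ := fun t s => 2 * s * (κ s * f (√(s ^ 2 + r ^ 2 - 2 * r * t))) with hH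
  have hHc : Continuous (Function.uncurry H) := by
    rw [hH]
    exact ((continuous_const.mul continuous_snd).mul
      ((hκ.comp continuous_snd).mul (hf.comp (Real.continuous_sqrt.comp (by fun_prop)))))
  set U : Set (ℝ × ℝ) := {p | |p.1| < p.2} with hU
  have hUo : IsOpen U := isOpen_lt (continuous_abs.comp continuous_fst) continuous_snd
  set F : ℝ × ℝ → ℝ := U.indicator (Function.uncurry H) with hF
  -- F vanishes off the box
  set B : Set (ℝ × ℝ) := Icc (-(r + T)) (r + T) ×ˢ Icc 0 (r + T) with hB
  have hBc : IsCompact B := (isCompact_Icc).prod isCompact_Icc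
  have hFz : ∀ p, p ∉ B → F p = 0 := by
    rintro ⟨t, s⟩ hp
    by_cases hu : ((t, s) : ℝ × ℝ) ∈ U
    · rw [hF, indicator_of_mem hu]
      have hts : |t| < s := hu
      have hs0 : 0 < s := (abs_nonneg t).trans_lt hts
      -- then s > r + T (else p ∈ B)
      have hsT : r + T < s := by
        by_contra hle
        push Not at hle
        apply hp
        refine ⟨⟨?_, ?_⟩, hs0.le, hle⟩
        · linarith [neg_abs_le t, hts.le]
        · linarith [le_abs_self t, hts.le]
      have ht : t < s := (le_abs_self t).trans_lt hts
      have hT' : T ≤ √(s ^ 2 + r ^ 2 - 2 * r * t) := by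
        rw [← Real.sqrt_sq hT0]
        refine Real.sqrt_le_sqrt ?_
        nlinarith
      simp [Function.uncurry, hH, hT _ hT']
    · rw [hF, indicator_of_notMem hu]
  -- F is bounded by the max of |H| on the box
  obtain ⟨M, hM⟩ := hBc.exists_bound_of_continuousOn hHc.continuousOn
  have hFint : Integrable F (volume.prod volume) := by
    have hg : Integrable (B.indicator fun _ => max M 0) (volume.prod volume) := by
      rw [integrable_indicator_iff (hBc.measurableSet)]
      exact integrableOn_const (hBc.measure_lt_top.ne) -- finite measure
    refine hg.mono' ?_ (Filter.Eventually.of_forall fun p => ?_)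
    · exact (hHc.aestronglyMeasurable).indicator hUo.measurableSet
    · by_cases hp : p ∈ B
      · rw [indicator_of_mem hp]
        by_cases hu : p ∈ U
        · rw [hF, indicator_of_mem hu]; exact (hM p hp).trans (le_max_left _ _)
        · rw [hF, indicator_of_notMem hu, norm_zero]; exact le_max_right _ _
      · rw [hFz p hp, norm_zero, indicator_of_notMem hp]
  -- LHS as an iterated integral of F
  have hL : ∀ t, ∫ s in Ioi |t|, H t s = ∫ s, F (t, s) := fun t => by
    rw [← integral_indicator measurableSet_Ioi]
    refine integral_congr_ae (Filter.Eventually.of_forall fun s => ?_)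
    show (Ioi |t|).indicator (H t) s = U.indicator (Function.uncurry H) (t, s)
    by_cases h : |t| < s
    · rw [indicator_of_mem (show s ∈ Ioi |t| from h), indicator_of_mem (show (t, s) ∈ U from h)]; rfl
    · rw [indicator_of_notMem (show s ∉ Ioi |t| from h), indicator_of_notMem (show (t, s) ∉ U from h)]
  -- RHS as an iterated integral of F
  have hR : ∀ s, ∫ t, F (t, s) = (Ioi (0:ℝ)).indicator (fun s => ∫ t in (-s)..s, H t s) s := fun s => by
    by_cases hs : 0 < s
    · rw [indicator_of_mem (show s ∈ Ioi 0 from hs), intervalIntegral.integral_of_le (by linarith : -s ≤ s),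
        integral_Ioc_eq_integral_Ioo, ← integral_indicator measurableSet_Ioo]
      refine integral_congr_ae (Filter.Eventually.of_forall fun t => ?_)
      show U.indicator (Function.uncurry H) (t, s) = (Ioo (-s) s).indicator (fun t => H t s) t
      by_cases h : |t| < s
      · rw [indicator_of_mem (show (t, s) ∈ U from h), indicator_of_mem (show t ∈ Ioo (-s) s from abs_lt.mp h)]; rfl
      · rw [indicator_of_notMem (show (t, s) ∉ U from h),
          indicator_of_notMem (show t ∉ Ioo (-s) s from fun h' => h (abs_lt.mpr h'))]
    · rw [indicator_of_notMem (show s ∉ Ioi 0 from hs)]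
      have : ∀ t, F (t, s) = 0 := fun t => by
        rw [hF, indicator_of_notMem]
        intro (h : |t| < s)
        exact hs ((abs_nonneg t).trans_lt h)
      simp [this]
  calc ∫ t, ∫ s in Ioi |t|, H t s = ∫ t, ∫ s, F (t, s) := by simp only [hL]
    _ = ∫ s, ∫ t, F (t, s) := by
        have e : (Function.uncurry fun t s => F (t, s)) = F := by funext ⟨t, s⟩; rfl
        exact integral_integral_swap (e ▸ hFint)
    _ = ∫ s, (Ioi (0:ℝ)).indicator (fun s => ∫ t in (-s)..s, H t s) s := by simp only [hR]
    _ = ∫ s in Ioi 0, ∫ t in (-s)..s, H t s := integral_indicator measurableSet_Ioi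

/-! ## §6. The radial convolution formula -/

/-- ★ **THE RADIAL CONVOLUTION FORMULA on the axis**: for continuous `κ`, `f` with `f` vanishing on `[T, ∞)` (`T ≥ 0`) and `r > 0`,
`∫_{ℝ³} κ(‖u‖) f(‖u − r e₀‖) du = (2π/r) ∫_{s>0} s κ(s) ∫_{|r−s|}^{r+s} τ f(τ) dτ ds`. [folklore] -/
theorem radial_convolution_axis (κ f : ℝ → ℝ) (hκ : Continuous κ) (hf : Continuous f) {T : ℝ} (hT0 : 0 ≤ T)
    (hT : ∀ x, T ≤ x → f x = 0) {r : ℝ} (hr : 0 < r) :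
    ∫ u : EuclideanSpace ℝ (Fin 3), κ ‖u‖ * f ‖u - r • e0‖ =
      2 * π / r * ∫ s in Ioi 0, s * κ s * ∫ τ in |r - s|..(r + s), τ * f τ := by
  -- integrability: continuous with compact support (the `f` factor)
  have hint : Integrable (fun u : EuclideanSpace ℝ (Fin 3) => κ ‖u‖ * f ‖u - r • e0‖) := by
    refine Continuous.integrable_of_hasCompactSupport ((hκ.comp continuous_norm).mul (hf.comp (by fun_prop))) ?_
    refine HasCompactSupport.intro (isCompact_closedBall (r • e0) T) fun u hu => ?_
    rw [Metric.mem_closedBall, dist_eq_norm, not_le] at hu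
    simp [hT _ hu.le]
  rw [integral_radialPair_slab κ f r hint]
  simp_rw [inner_subst κ f hκ hf hT]
  rw [integral_const_mul, swap_cone κ f hκ hf hT0 hT hr.le]
  rw [show 2 * π / r * (∫ s in Ioi 0, s * κ s * ∫ τ in |r - s|..(r + s), τ * f τ) =
      π * ∫ s in Ioi 0, 2 / r * (s * κ s * ∫ τ in |r - s|..(r + s), τ * f τ) by
    rw [integral_const_mul]; ring]
  congr 1
  refine setIntegral_congr_fun measurableSet_Ioi fun s (hs : 0 < s) => ?_
  rw [show (∫ t in (-s)..s, 2 * s * (κ s * f (√(s ^ 2 + r ^ 2 - 2 * r * t)))) =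
      2 * s * κ s * ∫ t in (-s)..s, f (√(s ^ 2 + r ^ 2 - 2 * r * t)) by
    rw [← intervalIntegral.integral_const_mul]
    refine intervalIntegral.integral_congr fun t _ => ?_
    ring]
  rw [inner_tau f hf hr hs.le]
  field_simp

/-- ★ **THE RADIAL CONVOLUTION FORMULA** (general centre): for `z ≠ 0`,
`∫_{ℝ³} κ(‖u‖) f(‖u − z‖) du = (2π/‖z‖) ∫_{s>0} s κ(s) ∫_{|‖z‖−s|}^{‖z‖+s} τ f(τ) dτ ds`. [folklore] -/
theorem radial_convolution (κ f : ℝ → ℝ) (hκ : Continuous κ) (hf : Continuous f) {T : ℝ} (hT0 : 0 ≤ T)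
    (hT : ∀ x, T ≤ x → f x = 0) {z : EuclideanSpace ℝ (Fin 3)} (hz : z ≠ 0) :
    ∫ u : EuclideanSpace ℝ (Fin 3), κ ‖u‖ * f ‖u - z‖ =
      2 * π / ‖z‖ * ∫ s in Ioi 0, s * κ s * ∫ τ in |‖z‖ - s|..(‖z‖ + s), τ * f τ := by
  rw [← radial_convolution_axis κ f hκ hf hT0 hT (norm_pos_iff.mpr hz)]
  set w : EuclideanSpace ℝ (Fin 3) := ‖z‖ • e0 with hw_def
  have hw : ‖z‖ = ‖w‖ := by rw [hw_def, norm_smul, norm_e0, mul_one, Real.norm_of_nonneg (norm_nonneg z)]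
  by_cases hzw : z = w
  · rw [← hzw]
  · set R : EuclideanSpace ℝ (Fin 3) ≃ₗᵢ[ℝ] EuclideanSpace ℝ (Fin 3) := ((ℝ ∙ (z - w))ᗮ).reflection with hR_def
    have hRz : R z = w := Submodule.reflection_sub hw
    have hcomp : (fun u : EuclideanSpace ℝ (Fin 3) => κ ‖u‖ * f ‖u - z‖) =
        fun u => (fun u' : EuclideanSpace ℝ (Fin 3) => κ ‖u'‖ * f ‖u' - w‖) (R.toHomeomorph.toMeasurableEquiv u) := by
      funext u
      simp only [Homeomorph.toMeasurableEquiv_coe, LinearIsometryEquiv.coe_toHomeomorph]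
      rw [LinearIsometryEquiv.norm_map, ← hRz, ← map_sub, LinearIsometryEquiv.norm_map]
    rw [hcomp]
    have hmp : MeasurePreserving R.toHomeomorph.toMeasurableEquiv volume volume := R.measurePreserving
    exact hmp.integral_comp' (fun u' : EuclideanSpace ℝ (Fin 3) => κ ‖u'‖ * f ‖u' - w‖)

end Summit.AtomisticToContinuum.Crystallization.Theorems.FrustratedLawDichotomyBumpAutocorrelation

end
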